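import Summits.QuantumFields.YangMills.Theorems.BalabanUVNodesN06Thm312313ParLawsQStar
import Literature.MathematicalPhysics.QuantumFieldTheory.Balaban1983to89.B9QstarLettersAtPinsL2
import Literature.MathematicalPhysics.QuantumFieldTheory.Balaban1983to89.Node00.OpsYSectDCoordsQ

/-!
# BalabanUVNodes ∕ N06 ([B9], `Dag.B9_main`) — CASCADE-K: THE DISPLAYED BLOCK-L² LAWS `hqsL2K` ∕ `hqL2K` OF THE KNIT SECT.-D NETWORK
# (dag-n06-d's `…N06AtOpsYSectEStKnitSectDKD.t312_t313_opsYSectESt_knit_KD`, the `…G0QstarL2LettersLegAtPinsPUPar` leg) — PART 4 of this seat's `ParLawsQ*`: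
# the block-L² letters of `Q⋆(U)` ∕ `Q(U)` FROM A COLUMN KERNEL WITH BOUNDED ROW MASS, and the KNIT PAIR OF RECORD on the member's local class (3.35)

Track A of `YM-PLAN.md` (cell `pub-ymgap`, HUMAN RULING D-0062), node **N06** = [Balaban1985BackgroundPropagators] Thms 3.1–3.15; rows 20–21, seat `pub-ymgap-dag-n06-l`
(g39); parts 1–3 = `…ParLawsQ` (`hC1T`), `…ParLawsQRow` (`hqK`, the knit ROW kernel), `…ParLawsQStar` (`hqsK`, the knit COLUMN bound).  WHY.  dag-n06-d's knit Sect.-D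
network KD (✓p790544) displays, besides the sup-class letters `hqsK ∕ hqK` (parts 2–3), the two BLOCK-L² letters of the averaging pair, `hqsL2K : … → BlockBd blkZ blk (Q⋆ U)
(BQL·(Lʲη(y))⁻¹·(√(n_{y′}⁻¹)L^{j′}η(y′))·e^{−δQs d})` and `hqL2K : … → BlockBd blk blkZ (Q U) (BQL·(√(n_y⁻¹)Lʲη(y))·(L^{j′}η(y′))⁻¹·e^{−δQs d})` — referee ref-A's census of KD
(READ-15, bus I.20680) lists exactly these two as «OPEN 2∕14» without a knit inhabitant.  At the STRAIGHT pair dag-n06-w5 proved them (`B9QstarLettersAtPinsL2.blockBd_QscoKH_len`,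
flat weights `q_{y′}(f) ≤ n_{y′}⁻¹` of mass one; `Q` by adjointness, `B9LettersZQstarFieldsAtPinsL2R.blockBd_Q_pinsB_len`).  At the KNIT pair `(QknitY, adjTrY QknitY)` the kinematics
is this seat's knit kernel `k ι f = q_ι(f) + K_col α₀′·boxK ι f` on (3.35): entries `≤ (1 + K_col α₀′)n_ι⁻¹` (`knitRow_le_plateau`), ROW MASS `≤ 1 + 2(d+1)K_col α₀′`
(`sum_knitRow_le`), support `ℓ + 4` (`dist_le_of_knitRow_ne_zero_bI`), `Q⋆`'s column bound `‖(Q⋆Ψ)(f)‖ ≤ N⁴Σ_ι k ι f‖Ψ ι‖` (`norm_adjTrY_apply_le_of_rowKernel`); the block-L²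
size needs one datum beyond the sup class — the row mass (Schur: `Σ_{f∈Δ(y)} k(y′,f)² ≤ (K₁n⁻¹)·K_r`).

WHAT IS PROVED (sorry-free; 0 `def`).
§1 (generic `𝔮⋆`, any carrier, any column kernel `k ≥ 0` with `k ι f ≤ K₁n_ι⁻¹`, `Σ_f k ι f ≤ K_r`, support `ℓ+4`, column bound with constant `C`): ★★ `blockBd_QscoKHq_of_colKernel` —
`BlockBd blkHK (blkBK bI) (QscoKHq … 𝔮⋆ U₁) (C·√(K₁K_r)·√(n_{y′}⁻¹)·e^{δ(ℓ+4)}·e^{−δd})`, every `δ ≥ 0` (w5's slice Cauchy–Schwarz with the flat kernel replaced by `k`); ★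
`blockBd_QscoKHq_of_colKernel_len` — the length-ratio form `(C√(K₁K_r)·L·e^{(δ+ε)(ℓ+4)})·(Lʲη(y))⁻¹·(√(n_{y′}⁻¹)L^{j′}η(y′))·e^{−δd}` above the [4] (2.60) threshold
`log L ≤ ε(2L²−1)M` (`len_pow_le_of_transfer`).
§2 (the knit pair on (3.35), `G ≤ U(N)`, `c₀ ≤ 10`, `0 ≤ Mα₀`, `0 < α₀′ ≤ α_Q`, `K_pl(Mα₀)L⁴ < α₀′`): ★★ `blockBd_QscoKHq_adjTrY_QknitY_of_reg335P` (`Q⋆`, constant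
`N⁴(1 + 2(d+1)K_col α₀′)·L·e^{(δ+ε)(ℓ+4)}`), ★★ `blockBd_QcoKHq_QknitY_of_reg335P` (`Q`, by adjointness: `isTransposePair_QcoKHq_QscoKHq` + `isAdjTr_adjTrY` + `blockBd_of_adjoint`).
§3 = the sequel file `…ParLawsQL2Knit` (★★★ `hqsL2K_knit_of_laws`, ★★★ `hqL2K_knit_of_laws`: KD's two binders VERBATIM at the knit pair of record).
HONEST FRAMING.  Finite-dimensional lattice bookkeeping (Schur ∕ Cauchy–Schwarz) for ONE kinematic letter over this seat's kernel-checked knit row form; regime bridge and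
numerics are HYPOTHESES; COUNT-NEUTRAL; nothing of [B9]'s propagator estimates asserted; N06 NOT discharged; K1⁹ NOT closed; one finite 𝕋⁴ programme at fixed `ε` — NOT
continuum, NOT OS, NOT the mass gap ∕ Clay.  0 `def`, 0 `sorry`.
[cite: Balaban1985BackgroundPropagators, (3.11)–(3.15) p.393, (3.46) p.398 + remark after (3.47) p.398, Thm 3.13 p.426 (the letters Q, Q\*), (3.115) p.418, (3.35) p.396;
Balaban1985Averaging, Prop. 2 p.26, (139)–(147) pp.39–40; Balaban1984PropagatorsI, (1.18) p.20; Balaban1984PropagatorsII, Lemma 2.1 (2.60) p.234, (2.51) p.232]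
-/

noncomputable section

namespace Summit.QuantumFields.YangMills.BalabanUVNodes.N06Thm312313ParLawsQL2

open scoped Matrix Matrix.Norms.L2Operator
open Literature.MathematicalPhysics.QuantumFieldTheory.Balaban1983to89
open Literature.MathematicalPhysics.QuantumFieldTheory.Balaban1983to89.Node00
open Literature.MathematicalPhysics.QuantumFieldTheory.Balaban1983to89.B6KLevelCensusIndexV1 (KIdx kGeo)
open Literature.MathematicalPhysics.QuantumFieldTheory.Balaban1983to89.B9CoReadingCoordsTranspose (TrIdx trBasis)
open Literature.MathematicalPhysics.QuantumFieldTheory.Balaban1983to89.B9CoReadingCoords (XBK blkBK)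
open Literature.MathematicalPhysics.QuantumFieldTheory.Balaban1983to89.B9CoReadingCoordsH (XHK blkHK)
open Literature.MathematicalPhysics.QuantumFieldTheory.Balaban1983to89.B9Thm39ReadingCoords (cR39 cR39_nonneg coordBound39 basisBound39)
open Literature.MathematicalPhysics.QuantumFieldTheory.Balaban1983to89.Node00.OpsYQLetter (QLetterY QsLetterY adjTrY isAdjTr_adjTrY)
open Literature.MathematicalPhysics.QuantumFieldTheory.Balaban1983to89.Node00.OpsYOps312OfRecordPar (QscoKHq QcoKHq)
open Literature.MathematicalPhysics.QuantumFieldTheory.Balaban1983to89.Node00.OpsYSectDCoordsQ (isTransposePair_QcoKHq_QscoKHq)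
open Literature.MathematicalPhysics.QuantumFieldTheory.Balaban1983to89.B6Geom246MultiLevelTorus (geomT)
open Literature.MathematicalPhysics.QuantumFieldTheory.Balaban1983to89.B6GlobalChartV1 (blkV1)
open Literature.MathematicalPhysics.QuantumFieldTheory.Balaban1983to89.B6Ineq2142KLevelV1 (lvl β qwt qwt_nonneg)
open Literature.MathematicalPhysics.QuantumFieldTheory.Balaban1983to89.B9GeoNormsKLevelV1 (geo9K)
open Literature.MathematicalPhysics.QuantumFieldTheory.Balaban1983to89.B9GeoLemma21KLevelV1 (geo9K_dist_comm geo9K_len_pos geo9K_one_le_L)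
open Literature.MathematicalPhysics.QuantumFieldTheory.Balaban1983to89.B9Thm34Ext (toB6)
open Literature.MathematicalPhysics.QuantumFieldTheory.Balaban1983to89.B9SectDL2Decay (bsq bl2 bl2_nonneg bsq_nonneg bl2_sq BlockBd blockBd_of_adjoint)
open Literature.MathematicalPhysics.QuantumFieldTheory.Balaban1983to89.B9QstarLettersAtPins (reading_const_collapse)
open Literature.MathematicalPhysics.QuantumFieldTheory.Balaban1983to89.B9Letters313AtOneQ (len_pow_le_of_transfer)
open Literature.MathematicalPhysics.QuantumFieldTheory.Balaban1983to89.B9Eq316AveragingTransposeZd (alphaQ)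
open Literature.MathematicalPhysics.QuantumFieldTheory.Balaban1983to89.B9Eq3115KnitLetterY (QknitY)
open Literature.MathematicalPhysics.QuantumFieldTheory.Balaban1983to89.B9Eq3115KnitLetterYOnto (kCol kCol_nonneg)
open Literature.MathematicalPhysics.QuantumFieldTheory.Balaban1983to89.B9Eq3115KnitLetterYRowCloseness (boxK boxK_nonneg)
open Literature.MathematicalPhysics.QuantumFieldTheory.Balaban1983to89.B9C2FormBoxRegimeY (Kpl)
open Literature.MathematicalPhysics.QuantumFieldTheory.Balaban1983to89.B9BackgroundsKLevelV1P (bg9KP)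
open Literature.MathematicalPhysics.QuantumFieldTheory.Balaban1983to89.B7Prop2Explicit (unitaryUnits)
open Literature.MathematicalPhysics.QuantumFieldTheory.Balaban1983to89.B9Thm37Glue (IsTransposePair)
open Summit.QuantumFields.YangMills.BalabanUVNodes.N06Thm312313ParLawsQRow (dist_le_of_knitRow_ne_zero_bI sum_knitRow_le norm_QknitY_apply_le_sum_knitRow)
open Summit.QuantumFields.YangMills.BalabanUVNodes.N06Thm312313ParLawsQStar (abs_QscoKHq_apply_le_of_col norm_adjTrY_apply_le_of_rowKernel knitRow_le_plateau)

variable {N : ℕ}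

/-! ## §1 The block-L² letter of `Q⋆(U₁)` from a COLUMN KERNEL with bounded ROW MASS (generic letter `𝔮⋆`, any carrier) -/

section Generic
variable {𝔸 : Type} [NormedRing 𝔸] [NormedAlgebra ℂ 𝔸] [CompleteSpace 𝔸] [FiniteDimensional ℝ 𝔸]
variable {κ : Type} [Fintype κ]
variable {d ℓ : ℕ} {hd : 1 ≤ d + 1} {hL : Odd (ℓ + 1) ∧ 1 < ℓ + 1} {b₀ b₁ : ℝ}
variable (i : KIdx d ℓ hd hL b₀ b₁) (b : Module.Basis κ ℝ 𝔸) (B : B9.Backgrounds) (cfg : B.Cfg → CfgY 𝔸 i) (𝔮s : QsLetterY 𝔸 i)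
variable {bI : FBondY i → IBondY i}

omit [Fintype κ] in
/-- product-form domination of a block square over a product carrier blocked through the first factor: if `|F(s,t)| ≤ A(s)·G(t)` then
`bsq (blk ∘ fst) y F ≤ bsq blk y A · Σ_t G(t)²`. [folklore] -/
private theorem bsq_le_prod_of_abs_le {G6 : B6.Geometry} {S T : Type} [Fintype S] [Fintype T] (blk : S → G6.Site) (y : G6.Site)
    {F : S × T → ℝ} {A : S → ℝ} {Gf : T → ℝ} (h : ∀ p, |F p| ≤ A p.1 * Gf p.2) :
    bsq (fun p : S × T => blk p.1) y F ≤ bsq blk y A * ∑ t, Gf t ^ 2 := by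
  classical
  unfold bsq
  rw [Fintype.sum_prod_type, Finset.sum_mul]
  refine Finset.sum_le_sum fun s _ => ?_
  split_ifs
  · rw [Finset.mul_sum]
    refine Finset.sum_le_sum fun t _ => ?_
    calc F (s, t) ^ 2 = |F (s, t)| ^ 2 := (sq_abs _).symm
      _ ≤ (A s * Gf t) ^ 2 := pow_le_pow_left₀ (abs_nonneg _) (h (s, t)) 2
      _ = A s ^ 2 * Gf t ^ 2 := by ring
  · simp

omit [Fintype κ] in
/-- a block square is at most `c·Σ g` when its squares are dominated termwise on the block by `c·g`, `g ≥ 0`, `c ≥ 0`. [folklore] -/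
private theorem bsq_le_const_mul_sum {G6 : B6.Geometry} {X : Type} [Fintype X] (blk : X → G6.Site) (y : G6.Site) {f g : X → ℝ} {c : ℝ}
    (hc : 0 ≤ c) (hg : ∀ x, 0 ≤ g x) (h : ∀ x, blk x = y → f x ^ 2 ≤ c * g x) : bsq blk y f ≤ c * ∑ x, g x := by
  classical
  unfold bsq
  rw [Finset.mul_sum]
  refine Finset.sum_le_sum fun x _ => ?_
  split_ifs with hx
  · exact h x hx
  · exact mul_nonneg hc (hg x)

/-- the squares of a coarse input over the `(ν, a, c′)`-slices at `y′` are at most its sharp block square at `y′` (blocked through `blkHK`). [folklore] -/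
private theorem sum_sq_slices_le_bsq_blkHK [Fintype (geo9K i).Site] (μ : XHK κ i → ℝ) (y' : IBondY i) {R₀ : ℝ} {H₀ : Prop} :
    ∑ ν : Fin (d + 1), ∑ c' : κ, ∑ a : κ, μ (y', ν, a, c') ^ 2 ≤ bsq (g := toB6 (geo9K i) R₀ H₀) (blkHK i) y' μ := by
  classical
  have hre : bsq (g := toB6 (geo9K i) R₀ H₀) (blkHK i) y' μ = ∑ q : XHK κ i, if q.1 = y' then μ q ^ 2 else 0 := by
    unfold bsq blkHK
    exact Finset.sum_congr rfl fun q _ => by congr 1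
  rw [hre, Fintype.sum_prod_type, Finset.sum_eq_single y']
  · simp only [if_true]
    rw [Fintype.sum_prod_type]
    refine Finset.sum_le_sum fun ν _ => ?_
    rw [Fintype.sum_prod_type, Finset.sum_comm]
  · intro y _ hy; simp [hy]
  · intro h; exact absurd (Finset.mem_univ y') h

/-- ★★ **THE BLOCK-L² LETTER OF `Q⋆(U₁)` FROM A COLUMN KERNEL WITH BOUNDED ROW MASS** (w5's `blockBd_QscoKH` with the flat kernel `q_{y′}(f)` replaced by any `k ≥ 0` with
`k ι f ≤ K₁·n_ι⁻¹`, `Σ_f k ι f ≤ K_r`, vanishing unless `d(ι, bI f) ≤ ℓ + 4`, and a column bound `‖(𝔮⋆Ψ)(f)‖ ≤ C·Σ_ι k ι f‖Ψ ι‖`): for `bI` 1-faithful,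
`‖1_{Δ(y)}Q⋆(U₁)μ‖₂ ≤ C·√(K₁K_r)·√(n_{y′}⁻¹)·e^{δ(ℓ+4)}·e^{−δd(y,y′)}·‖1_{Δ(y′)}μ‖₂` (`supp μ ⊂ Δ(y′)`), every `δ ≥ 0` — Cauchy–Schwarz in the `|κ|` real coordinates of
each slice, Schur `Σ_{f∈Δ(y)} k(y′,f)² ≤ (K₁n_{y′}⁻¹)·K_r`, the reading constant collapsing.
[cite: Balaban1985BackgroundPropagators, (3.12)–(3.15) p.393, (3.110) p.417, (3.46) p.398, Thm 3.13 p.426 (the letter Q\*), (3.115) p.418; Balaban1984PropagatorsI, (1.18) p.20] -/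
theorem blockBd_QscoKHq_of_colKernel
    (hβ1 : ∀ f : FBondY i, (geomT i.D).dist (β i.hN i.D i.hk (bI f)) (blkV1 i.hN i.D f) ≤ 1) {U₁ : B.Cfg}
    (k : IBondY i → FBondY i → ℝ) (hk : ∀ ι f, 0 ≤ k ι f)
    (hsupp : ∀ ι f, k ι f ≠ 0 → (geo9K i).dist ι (bI f) ≤ (ℓ : ℝ) + 4) {K₁ : ℝ} (hK₁ : 0 ≤ K₁)
    (hkle : ∀ ι f, k ι f ≤ K₁ * ((((ℓ + 1 : ℕ) : ℝ) ^ (d + 1)) ^ lvl i.hN i.D i.hk ι)⁻¹) {Kr : ℝ} (hKr : 0 ≤ Kr)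
    (hkrow : ∀ ι, ∑ f, k ι f ≤ Kr) {C : ℝ} (hC : 0 ≤ C)
    (hcol : ∀ (Ψ : IBondY i → 𝔸) (f : FBondY i), ‖𝔮s (cfg U₁) Ψ f‖ ≤ C * ∑ ι, k ι f * ‖Ψ ι‖)
    {δ : ℝ} (hδ : 0 ≤ δ) (R₀ : ℝ) (H₀ : Prop) [Fintype (geo9K i).Site] :
    BlockBd (g := toB6 (geo9K i) R₀ H₀) (blkHK i) (blkBK i bI) (QscoKHq i b B cfg 𝔮s U₁)
      (fun y y' => C * Real.sqrt (K₁ * Kr) * Real.sqrt (((((ℓ + 1 : ℕ) : ℝ) ^ (d + 1)) ^ lvl i.hN i.D i.hk y')⁻¹) *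
        (Real.exp (δ * ((ℓ : ℝ) + 4)) * Real.exp (-(δ * (geo9K i).dist y y')))) := by
  classical
  have _ := hβ1
  intro y' μ hoff y
  change IBondY i at y' y
  have hoff' : ∀ q : XHK κ i, q.1 ≠ y' → μ q = 0 := fun q hq => hoff q hq
  -- letters
  set pl : ℝ := ((((ℓ + 1 : ℕ) : ℝ) ^ (d + 1)) ^ lvl i.hN i.D i.hk y')⁻¹ with hpl
  set C₀ : ℝ := (cR39 b)⁻¹ * (coordBound39 b * basisBound39 b) with hC₀
  set S : Fin (d + 1) × κ × κ → ℝ := fun t => ∑ a, |μ (y', t.1, a, t.2.2)| with hS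
  set E : ℝ := Real.exp (δ * ((ℓ : ℝ) + 4)) * Real.exp (-(δ * (geo9K i).dist y y')) with hEdef
  have hpl0 : 0 ≤ pl := by positivity
  have hC₀0 : 0 ≤ C₀ := mul_nonneg (inv_nonneg.mpr (cR39_nonneg b)) (mul_nonneg (norm_nonneg _) (Finset.sum_nonneg fun _ _ => norm_nonneg _))
  -- pointwise: |Q⋆μ (f, t)| ≤ k y′ f · (C·C₀·S t)
  have hpt : ∀ p : XBK κ i, |QscoKHq i b B cfg 𝔮s U₁ μ p| ≤ k y' p.1 * (C * (C₀ * S p.2)) := fun p => by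
    have := abs_QscoKHq_apply_le_of_col i b B cfg 𝔮s U₁ k hk hC hcol hoff' p
    simp only [hC₀, hS]
    calc |QscoKHq i b B cfg 𝔮s U₁ μ p| ≤ _ := this
      _ = _ := by ring
  -- the square sum factorises through the product carrier `FBondY × (ν, c, c′)`
  have hbsq : bsq (g := toB6 (geo9K i) R₀ H₀) (blkBK i bI) y (QscoKHq i b B cfg 𝔮s U₁ μ) ≤
      bsq (g := toB6 (geo9K i) R₀ H₀) bI y (k y') * ∑ t : Fin (d + 1) × κ × κ, (C * (C₀ * S t)) ^ 2 :=
    bsq_le_prod_of_abs_le (G6 := toB6 (geo9K i) R₀ H₀) bI y hpt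
  -- Schur on the first factor: Σ_{f∈Δ(y)} k(y′,f)² ≤ (K₁n⁻¹)·Σ_f k(y′,f) ≤ K₁·K_r·n⁻¹, and = 0 off the radius ℓ + 4
  have hq2 : bsq (g := toB6 (geo9K i) R₀ H₀) bI y (k y') ≤ K₁ * pl * Kr := by
    refine (bsq_le_const_mul_sum (G6 := toB6 (geo9K i) R₀ H₀) bI y (c := K₁ * pl) (mul_nonneg hK₁ hpl0) (hk y') fun f _ => ?_).trans
      (mul_le_mul_of_nonneg_left (hkrow y') (mul_nonneg hK₁ hpl0))
    rw [sq]
    exact mul_le_mul_of_nonneg_right (hkle y' f) (hk y' f)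
  have hq2far : ¬ (geo9K i).dist y y' ≤ (ℓ : ℝ) + 4 → bsq (g := toB6 (geo9K i) R₀ H₀) bI y (k y') ≤ 0 := fun hfar => by
    refine (bsq_le_const_mul_sum (G6 := toB6 (geo9K i) R₀ H₀) bI y (c := 0) le_rfl (hk y') fun f hf => ?_).trans (by rw [zero_mul])
    have hkz : k y' f = 0 := by
      by_contra hq
      exact hfar (by rw [← hf, geo9K_dist_comm]; exact hsupp _ _ hq)
    rw [hkz]; norm_num
  have hq2' : bsq (g := toB6 (geo9K i) R₀ H₀) bI y (k y') ≤ K₁ * Kr * pl * E ^ 2 := by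
    by_cases hnear : (geo9K i).dist y y' ≤ (ℓ : ℝ) + 4
    · have hK1 : 1 ≤ E := by
        rw [hEdef, ← Real.exp_add]
        exact Real.one_le_exp (by nlinarith [mul_le_mul_of_nonneg_left hnear hδ])
      calc _ ≤ K₁ * pl * Kr := hq2
        _ = K₁ * Kr * pl * 1 ^ 2 := by ring
        _ ≤ _ := mul_le_mul_of_nonneg_left (pow_le_pow_left₀ zero_le_one hK1 2) (by positivity)
    · exact (hq2far hnear).trans (by positivity)
  -- second factor: Cauchy–Schwarz in the coordinate `a`, then the slices add up to the block square
  have hS2 : ∑ t : Fin (d + 1) × κ × κ, (C * (C₀ * S t)) ^ 2 ≤ (C * (C₀ * (Fintype.card κ : ℝ))) ^ 2 * bsq (g := toB6 (geo9K i) R₀ H₀) (blkHK i) y' μ := by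
    have hcs : ∀ t : Fin (d + 1) × κ × κ, S t ^ 2 ≤ (Fintype.card κ : ℝ) * ∑ a, μ (y', t.1, a, t.2.2) ^ 2 := fun t => by
      have h := sq_sum_le_card_mul_sum_sq (s := (Finset.univ : Finset κ)) (f := fun a => |μ (y', t.1, a, t.2.2)|)
      simp only [Finset.card_univ, sq_abs] at h
      exact h
    calc ∑ t : Fin (d + 1) × κ × κ, (C * (C₀ * S t)) ^ 2 = ∑ t : Fin (d + 1) × κ × κ, (C * C₀) ^ 2 * S t ^ 2 :=
          Finset.sum_congr rfl fun t _ => by ring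
      _ ≤ ∑ t : Fin (d + 1) × κ × κ, (C * C₀) ^ 2 * ((Fintype.card κ : ℝ) * ∑ a, μ (y', t.1, a, t.2.2) ^ 2) :=
          Finset.sum_le_sum fun t _ => mul_le_mul_of_nonneg_left (hcs t) (sq_nonneg _)
      _ = (C * C₀) ^ 2 * (Fintype.card κ : ℝ) * ∑ t : Fin (d + 1) × κ × κ, ∑ a, μ (y', t.1, a, t.2.2) ^ 2 := by
          rw [Finset.mul_sum]; exact Finset.sum_congr rfl fun t _ => by ring
      _ = (C * C₀) ^ 2 * (Fintype.card κ : ℝ) * ((Fintype.card κ : ℝ) * ∑ ν : Fin (d + 1), ∑ c' : κ, ∑ a : κ, μ (y', ν, a, c') ^ 2) := by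
          congr 1
          rw [Fintype.sum_prod_type, Finset.mul_sum]
          refine Finset.sum_congr rfl fun ν _ => ?_
          simp only [Fintype.sum_prod_type, Finset.sum_const, Finset.card_univ, nsmul_eq_mul]
      _ ≤ (C * C₀) ^ 2 * (Fintype.card κ : ℝ) * ((Fintype.card κ : ℝ) * bsq (g := toB6 (geo9K i) R₀ H₀) (blkHK i) y' μ) :=
          mul_le_mul_of_nonneg_left (mul_le_mul_of_nonneg_left (sum_sq_slices_le_bsq_blkHK i μ y') (Nat.cast_nonneg _))
            (mul_nonneg (sq_nonneg _) (Nat.cast_nonneg _))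
      _ = (C * (C₀ * (Fintype.card κ : ℝ))) ^ 2 * bsq (g := toB6 (geo9K i) R₀ H₀) (blkHK i) y' μ := by ring
  -- the reading constant collapses: C₀·|κ| ≤ 1
  have hCκ : C₀ * (Fintype.card κ : ℝ) ≤ 1 := by
    have h1 := reading_const_collapse b (κ := κ) (Bμ := 1) zero_le_one
    simp only [hC₀]
    calc (cR39 b)⁻¹ * (coordBound39 b * basisBound39 b) * (Fintype.card κ : ℝ)
        = (cR39 b)⁻¹ * (coordBound39 b * (basisBound39 b * ((Fintype.card κ : ℝ) * 1))) := by ring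
      _ ≤ 1 := h1
  have hCκ0 : 0 ≤ C₀ * (Fintype.card κ : ℝ) := mul_nonneg hC₀0 (Nat.cast_nonneg _)
  have hCC : (C * (C₀ * (Fintype.card κ : ℝ))) ^ 2 ≤ C ^ 2 := by
    rw [mul_pow]
    calc C ^ 2 * (C₀ * (Fintype.card κ : ℝ)) ^ 2 ≤ C ^ 2 * 1 ^ 2 :=
          mul_le_mul_of_nonneg_left (pow_le_pow_left₀ hCκ0 hCκ 2) (sq_nonneg _)
      _ = C ^ 2 := by ring
  -- assemble
  have hb0 : 0 ≤ bsq (g := toB6 (geo9K i) R₀ H₀) (blkHK i) y' μ := bsq_nonneg _ _ _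
  have hsq : bsq (g := toB6 (geo9K i) R₀ H₀) (blkBK i bI) y (QscoKHq i b B cfg 𝔮s U₁ μ) ≤
      (C * Real.sqrt (K₁ * Kr) * Real.sqrt pl * E * bl2 (g := toB6 (geo9K i) R₀ H₀) (blkHK i) y' μ) ^ 2 := by
    calc bsq (g := toB6 (geo9K i) R₀ H₀) (blkBK i bI) y (QscoKHq i b B cfg 𝔮s U₁ μ)
        ≤ bsq (g := toB6 (geo9K i) R₀ H₀) bI y (k y') * ∑ t : Fin (d + 1) × κ × κ, (C * (C₀ * S t)) ^ 2 := hbsq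
      _ ≤ (K₁ * Kr * pl * E ^ 2) * ((C * (C₀ * (Fintype.card κ : ℝ))) ^ 2 * bsq (g := toB6 (geo9K i) R₀ H₀) (blkHK i) y' μ) :=
          mul_le_mul hq2' hS2 (Finset.sum_nonneg fun _ _ => sq_nonneg _) (by positivity)
      _ ≤ (K₁ * Kr * pl * E ^ 2) * (C ^ 2 * bsq (g := toB6 (geo9K i) R₀ H₀) (blkHK i) y' μ) :=
          mul_le_mul_of_nonneg_left (mul_le_mul_of_nonneg_right hCC hb0) (by positivity)
      _ = (C * Real.sqrt (K₁ * Kr) * Real.sqrt pl * E * bl2 (g := toB6 (geo9K i) R₀ H₀) (blkHK i) y' μ) ^ 2 := by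
          simp only [mul_pow, Real.sq_sqrt hpl0, Real.sq_sqrt (mul_nonneg hK₁ hKr), bl2_sq]; ring
  have hR0 : 0 ≤ C * Real.sqrt (K₁ * Kr) * Real.sqrt pl * E * bl2 (g := toB6 (geo9K i) R₀ H₀) (blkHK i) y' μ :=
    mul_nonneg (by positivity) (bl2_nonneg _ _ _)
  calc bl2 (g := toB6 (geo9K i) R₀ H₀) (blkBK i bI) y (QscoKHq i b B cfg 𝔮s U₁ μ)
      = Real.sqrt (bsq (g := toB6 (geo9K i) R₀ H₀) (blkBK i bI) y (QscoKHq i b B cfg 𝔮s U₁ μ)) := rfl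
    _ ≤ Real.sqrt ((C * Real.sqrt (K₁ * Kr) * Real.sqrt pl * E * bl2 (g := toB6 (geo9K i) R₀ H₀) (blkHK i) y' μ) ^ 2) := Real.sqrt_le_sqrt hsq
    _ = C * Real.sqrt (K₁ * Kr) * Real.sqrt pl * E * bl2 (g := toB6 (geo9K i) R₀ H₀) (blkHK i) y' μ := Real.sqrt_sq hR0
    _ = _ := by rw [hEdef]

/-- ★ **THE BLOCK-L² LETTER FROM A COLUMN KERNEL, LENGTH-RATIO FORM** (w5's `blockBd_QscoKH_len`, kernel-generic): above the [4] (2.60) transfer threshold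
`log L ≤ ε(2L² − 1)M`, `‖1_{Δ(y)}Q⋆μ‖₂ ≤ (C√(K₁K_r)·L·e^{(δ+ε)(ℓ+4)})·(Lʲη(y))⁻¹·(√(n_{y′}⁻¹)·L^{j′}η(y′))·e^{−δd(y,y′)}·‖1_{Δ(y′)}μ‖₂` — `Lʲη ≤ L·e^{εd}·L^{j′}η` costs the rate `ε`
on the support radius. [cite: Balaban1985BackgroundPropagators, (3.46) p.398 + remark after (3.47) p.398, Thm 3.13 p.426; Balaban1984PropagatorsII, Lemma 2.1 (2.60) p.234] -/
theorem blockBd_QscoKHq_of_colKernel_len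
    (hβ1 : ∀ f : FBondY i, (geomT i.D).dist (β i.hN i.D i.hk (bI f)) (blkV1 i.hN i.D f) ≤ 1) {U₁ : B.Cfg}
    (k : IBondY i → FBondY i → ℝ) (hk : ∀ ι f, 0 ≤ k ι f)
    (hsupp : ∀ ι f, k ι f ≠ 0 → (geo9K i).dist ι (bI f) ≤ (ℓ : ℝ) + 4) {K₁ : ℝ} (hK₁ : 0 ≤ K₁)
    (hkle : ∀ ι f, k ι f ≤ K₁ * ((((ℓ + 1 : ℕ) : ℝ) ^ (d + 1)) ^ lvl i.hN i.D i.hk ι)⁻¹) {Kr : ℝ} (hKr : 0 ≤ Kr)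
    (hkrow : ∀ ι, ∑ f, k ι f ≤ Kr) {C : ℝ} (hC : 0 ≤ C)
    (hcol : ∀ (Ψ : IBondY i → 𝔸) (f : FBondY i), ‖𝔮s (cfg U₁) Ψ f‖ ≤ C * ∑ ι, k ι f * ‖Ψ ι‖)
    {δ ε : ℝ} (hδ : 0 ≤ δ) (hε : 0 < ε)
    (hM : Real.log (geo9K i).L ≤ ε * (2 * ((ℓ : ℝ) + 1) ^ 2 - 1) * (geo9K i).M)
    (R₀ : ℝ) (H₀ : Prop) [Fintype (geo9K i).Site] :
    BlockBd (g := toB6 (geo9K i) R₀ H₀) (blkHK i) (blkBK i bI) (QscoKHq i b B cfg 𝔮s U₁)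
      (fun y y' => (C * Real.sqrt (K₁ * Kr) * (geo9K i).L * Real.exp ((δ + ε) * ((ℓ : ℝ) + 4))) * ((geo9K i).len y)⁻¹ *
        (Real.sqrt (((((ℓ + 1 : ℕ) : ℝ) ^ (d + 1)) ^ lvl i.hN i.D i.hk y')⁻¹) * (geo9K i).len y') *
          Real.exp (-(δ * (geo9K i).dist y y'))) := by
  have hδε : 0 ≤ δ + ε := by linarith
  refine (blockBd_QscoKHq_of_colKernel i b B cfg 𝔮s hβ1 k hk hsupp hK₁ hkle hKr hkrow hC hcol hδε R₀ H₀).mono fun y y' => ?_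
  change IBondY i at y y'
  have hly : 0 < (geo9K i).len y := geo9K_len_pos i y
  have hM1 : ((1 : ℕ) : ℝ) * Real.log (geo9K i).L ≤ ε * (2 * ((ℓ : ℝ) + 1) ^ 2 - 1) * (geo9K i).M := by
    rw [Nat.cast_one, one_mul]; exact hM
  have ht := len_pow_le_of_transfer i hε 1 hM1 y' y
  rw [pow_one, pow_one, pow_one, geo9K_dist_comm] at ht
  have h1 : (1 : ℝ) ≤ (geo9K i).L * Real.exp (ε * (geo9K i).dist y y') * (((geo9K i).len y)⁻¹ * (geo9K i).len y') := by
    rw [show (geo9K i).L * Real.exp (ε * (geo9K i).dist y y') * (((geo9K i).len y)⁻¹ * (geo9K i).len y') =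
      ((geo9K i).len y)⁻¹ * ((geo9K i).L * Real.exp (ε * (geo9K i).dist y y') * (geo9K i).len y') by ring]
    rw [le_inv_mul_iff₀ hly, mul_one]
    exact ht
  have hE : Real.exp (-((δ + ε) * (geo9K i).dist y y')) * Real.exp (ε * (geo9K i).dist y y') =
      Real.exp (-(δ * (geo9K i).dist y y')) := by rw [← Real.exp_add]; congr 1; ring
  have hA0 : 0 ≤ C * Real.sqrt (K₁ * Kr) * Real.sqrt (((((ℓ + 1 : ℕ) : ℝ) ^ (d + 1)) ^ lvl i.hN i.D i.hk y')⁻¹) *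
      (Real.exp ((δ + ε) * ((ℓ : ℝ) + 4)) * Real.exp (-((δ + ε) * (geo9K i).dist y y'))) := by positivity
  calc C * Real.sqrt (K₁ * Kr) * Real.sqrt (((((ℓ + 1 : ℕ) : ℝ) ^ (d + 1)) ^ lvl i.hN i.D i.hk y')⁻¹) *
        (Real.exp ((δ + ε) * ((ℓ : ℝ) + 4)) * Real.exp (-((δ + ε) * (geo9K i).dist y y')))
      = C * Real.sqrt (K₁ * Kr) * Real.sqrt (((((ℓ + 1 : ℕ) : ℝ) ^ (d + 1)) ^ lvl i.hN i.D i.hk y')⁻¹) *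
        (Real.exp ((δ + ε) * ((ℓ : ℝ) + 4)) * Real.exp (-((δ + ε) * (geo9K i).dist y y'))) * 1 := (mul_one _).symm
    _ ≤ C * Real.sqrt (K₁ * Kr) * Real.sqrt (((((ℓ + 1 : ℕ) : ℝ) ^ (d + 1)) ^ lvl i.hN i.D i.hk y')⁻¹) *
        (Real.exp ((δ + ε) * ((ℓ : ℝ) + 4)) * Real.exp (-((δ + ε) * (geo9K i).dist y y'))) *
          ((geo9K i).L * Real.exp (ε * (geo9K i).dist y y') * (((geo9K i).len y)⁻¹ * (geo9K i).len y')) :=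
        mul_le_mul_of_nonneg_left h1 hA0
    _ = (C * Real.sqrt (K₁ * Kr) * (geo9K i).L * Real.exp ((δ + ε) * ((ℓ : ℝ) + 4))) * ((geo9K i).len y)⁻¹ *
          (Real.sqrt (((((ℓ + 1 : ℕ) : ℝ) ^ (d + 1)) ^ lvl i.hN i.D i.hk y')⁻¹) * (geo9K i).len y') *
          (Real.exp (-((δ + ε) * (geo9K i).dist y y')) * Real.exp (ε * (geo9K i).dist y y')) := by ring
    _ = _ := by rw [hE]

end Generic

/-! ## §2 The knit pair `(QknitY, adjTrY QknitY)` on the member's local class (3.35): `Q⋆` by the column bound, `Q` by adjointness -/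

section Knit

variable {d ℓ : ℕ} {hd : 1 ≤ d + 1} {hL : Odd (ℓ + 1) ∧ 1 < ℓ + 1} {b₀ b₁ : ℝ} (i : KIdx d ℓ hd hL b₀ b₁) {bI : FBondY i → IBondY i}
variable [Nonempty (Fin N)]

/-- `√((1 + K_col α₀′)(1 + 2(d+1)K_col α₀′)) ≤ 1 + 2(d+1)K_col α₀′` (the entry size is below the row mass). [cite: Balaban1985Averaging, (139)–(147) pp.39–40, bookkeeping] -/
private theorem sqrt_K₁_Kr_le {α₀' : ℝ} (hα : 0 ≤ α₀') :
    Real.sqrt ((1 + kCol (d + 1) (ℓ + 1) * α₀') * (1 + kCol (d + 1) (ℓ + 1) * α₀' * (2 * ((d : ℝ) + 1)))) ≤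
      1 + kCol (d + 1) (ℓ + 1) * α₀' * (2 * ((d : ℝ) + 1)) := by
  have hk0 : 0 ≤ kCol (d + 1) (ℓ + 1) * α₀' := mul_nonneg (kCol_nonneg _ _) hα
  have hd0 : (0 : ℝ) ≤ d := Nat.cast_nonneg d
  have hle : 1 + kCol (d + 1) (ℓ + 1) * α₀' ≤ 1 + kCol (d + 1) (ℓ + 1) * α₀' * (2 * ((d : ℝ) + 1)) := by nlinarith
  have hK0 : 0 ≤ 1 + kCol (d + 1) (ℓ + 1) * α₀' * (2 * ((d : ℝ) + 1)) := by positivity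
  calc Real.sqrt ((1 + kCol (d + 1) (ℓ + 1) * α₀') * (1 + kCol (d + 1) (ℓ + 1) * α₀' * (2 * ((d : ℝ) + 1))))
      ≤ Real.sqrt ((1 + kCol (d + 1) (ℓ + 1) * α₀' * (2 * ((d : ℝ) + 1))) * (1 + kCol (d + 1) (ℓ + 1) * α₀' * (2 * ((d : ℝ) + 1)))) :=
        Real.sqrt_le_sqrt (mul_le_mul_of_nonneg_right hle hK0)
    _ = 1 + kCol (d + 1) (ℓ + 1) * α₀' * (2 * ((d : ℝ) + 1)) := by rw [Real.sqrt_mul_self hK0]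

/-- ★★ **THE BLOCK-L² LETTER OF `Q⋆(U) = adjTrY (QknitY i U)` ON THE MEMBER's LOCAL CLASS (3.35), LENGTH-RATIO FORM**: at def-Y's coordinate model `QscoKHq … 𝔮⋆ U₁` of any
letter `𝔮⋆` with `𝔮⋆(cfg U₁) = adjTrY (QknitY i (cfg U₁))`, for a member background `cfg U₁ ∈ (bg9KP …).Reg335 c₀ α₀` (`G ≤ U(N)`, `c₀ ≤ 10`, `0 ≤ Mα₀`, `0 < α₀′ ≤ α_Q`,
`K_pl(Mα₀)·L⁴ < α₀′`) and above the (2.60) threshold `log L ≤ ε(2L²−1)M`: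
`BlockBd blkHK (blkBK bI) (Q⋆) ((N⁴(1 + 2(d+1)K_col α₀′)·L·e^{(δ+ε)(ℓ+4)})·(Lʲη(y))⁻¹·(√(n_{y′}⁻¹)L^{j′}η(y′))·e^{−δd})`, every `δ ≥ 0`.
[cite: Balaban1985BackgroundPropagators, Thm 3.13 p.426 (the letter Q\*), (3.46) p.398, (3.11)–(3.15) p.393, (3.115) p.418, (3.35) p.396; Balaban1985Averaging, Prop. 2 p.26, (139)–(147) pp.39–40; Balaban1984PropagatorsII, Lemma 2.1 (2.60) p.234] -/
theorem blockBd_QscoKHq_adjTrY_QknitY_of_reg335P [Fintype (geo9K i).Site]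
    (hβ1 : ∀ f : FBondY i, (geomT i.D).dist (β i.hN i.D i.hk (bI f)) (blkV1 i.hN i.D f) ≤ 1)
    {G : Subgroup (Matrix (Fin N) (Fin N) ℂ)ˣ} (hGU : G ≤ unitaryUnits (Matrix (Fin N) (Fin N) ℂ))
    (B : B9.Backgrounds) (cfg : B.Cfg → CfgY (Matrix (Fin N) (Fin N) ℂ) i) (𝔮s : QsLetterY (Matrix (Fin N) (Fin N) ℂ) i) {U₁ : B.Cfg}
    (h𝔮s : 𝔮s (cfg U₁) = adjTrY (QknitY i (cfg U₁))) {c₀ α₀ : ℝ} (hc : c₀ ≤ 10) (hMα : 0 ≤ (kGeo i).M * α₀)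
    (hreg : (bg9KP (Matrix (Fin N) (Fin N) ℂ) G i).Reg335 c₀ α₀ (cfg U₁)) {α₀' : ℝ} (hα' : 0 < α₀') (hαQ : α₀' ≤ alphaQ (d + 1) (ℓ + 1))
    (hK : Kpl i ((kGeo i).M * α₀) * (kGeo i).L ^ 4 < α₀') {δ ε : ℝ} (hδ : 0 ≤ δ) (hε : 0 < ε)
    (hM : Real.log (geo9K i).L ≤ ε * (2 * ((ℓ : ℝ) + 1) ^ 2 - 1) * (geo9K i).M) (R₀ : ℝ) (H₀ : Prop) :
    BlockBd (g := toB6 (geo9K i) R₀ H₀) (blkHK i) (blkBK i bI) (QscoKHq i (trBasis N) B cfg 𝔮s U₁)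
      (fun y y' => ((N : ℝ) ^ 4 * (1 + kCol (d + 1) (ℓ + 1) * α₀' * (2 * ((d : ℝ) + 1))) * (geo9K i).L * Real.exp ((δ + ε) * ((ℓ : ℝ) + 4))) *
        ((geo9K i).len y)⁻¹ * (Real.sqrt (((((ℓ + 1 : ℕ) : ℝ) ^ (d + 1)) ^ lvl i.hN i.D i.hk y')⁻¹) * (geo9K i).len y') *
          Real.exp (-(δ * (geo9K i).dist y y'))) := by
  have hk : ∀ ι f, 0 ≤ qwt i.hN i.D i.hk ι f + kCol (d + 1) (ℓ + 1) * α₀' * boxK i ι f :=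
    fun ι f => add_nonneg (qwt_nonneg _ _ _ _ _) (mul_nonneg (mul_nonneg (kCol_nonneg _ _) hα'.le) (boxK_nonneg i ι f))
  have hcol : ∀ (Ψ : IBondY i → Matrix (Fin N) (Fin N) ℂ) (f : FBondY i),
      ‖𝔮s (cfg U₁) Ψ f‖ ≤ (N : ℝ) ^ 4 * ∑ ι, (qwt i.hN i.D i.hk ι f + kCol (d + 1) (ℓ + 1) * α₀' * boxK i ι f) * ‖Ψ ι‖ := by
    intro Ψ f
    rw [h𝔮s]
    exact norm_adjTrY_apply_le_of_rowKernel i (QknitY i (cfg U₁)) _ hk (norm_QknitY_apply_le_sum_knitRow i hGU hc hMα hreg hα' hαQ hK) Ψ f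
  have hK₁ : 0 ≤ 1 + kCol (d + 1) (ℓ + 1) * α₀' := by have := kCol_nonneg (d + 1) (ℓ + 1); positivity
  have hKr : 0 ≤ 1 + kCol (d + 1) (ℓ + 1) * α₀' * (2 * ((d : ℝ) + 1)) := by have := kCol_nonneg (d + 1) (ℓ + 1); positivity
  have h := blockBd_QscoKHq_of_colKernel_len i (trBasis N) B cfg 𝔮s hβ1 _ hk (fun _ _ h => dist_le_of_knitRow_ne_zero_bI i hβ1 h) hK₁
    (knitRow_le_plateau i hα'.le) hKr (sum_knitRow_le i hα'.le) (by positivity) hcol hδ hε hM R₀ H₀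
  refine h.mono fun y y' => ?_
  have hrest : 0 ≤ ((geo9K i).len y)⁻¹ * (Real.sqrt (((((ℓ + 1 : ℕ) : ℝ) ^ (d + 1)) ^ lvl i.hN i.D i.hk y')⁻¹) * (geo9K i).len y') *
      Real.exp (-(δ * (geo9K i).dist y y')) :=
    mul_nonneg (mul_nonneg (inv_nonneg.mpr (geo9K_len_pos i _).le) (mul_nonneg (Real.sqrt_nonneg _) (geo9K_len_pos i _).le)) (Real.exp_nonneg _)
  have hL0 : 0 ≤ (geo9K i).L := zero_le_one.trans (geo9K_one_le_L i)
  have hN4 : 0 ≤ (N : ℝ) ^ 4 := by positivity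
  have hc : (N : ℝ) ^ 4 * Real.sqrt ((1 + kCol (d + 1) (ℓ + 1) * α₀') * (1 + kCol (d + 1) (ℓ + 1) * α₀' * (2 * ((d : ℝ) + 1)))) * (geo9K i).L *
        Real.exp ((δ + ε) * ((ℓ : ℝ) + 4)) ≤
      (N : ℝ) ^ 4 * (1 + kCol (d + 1) (ℓ + 1) * α₀' * (2 * ((d : ℝ) + 1))) * (geo9K i).L * Real.exp ((δ + ε) * ((ℓ : ℝ) + 4)) :=
    mul_le_mul_of_nonneg_right (mul_le_mul_of_nonneg_right (mul_le_mul_of_nonneg_left (sqrt_K₁_Kr_le hα'.le) hN4) hL0) (Real.exp_nonneg _)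
  calc (N : ℝ) ^ 4 * Real.sqrt ((1 + kCol (d + 1) (ℓ + 1) * α₀') * (1 + kCol (d + 1) (ℓ + 1) * α₀' * (2 * ((d : ℝ) + 1)))) * (geo9K i).L *
          Real.exp ((δ + ε) * ((ℓ : ℝ) + 4)) * ((geo9K i).len y)⁻¹ *
        (Real.sqrt (((((ℓ + 1 : ℕ) : ℝ) ^ (d + 1)) ^ lvl i.hN i.D i.hk y')⁻¹) * (geo9K i).len y') * Real.exp (-(δ * (geo9K i).dist y y'))
      = ((N : ℝ) ^ 4 * Real.sqrt ((1 + kCol (d + 1) (ℓ + 1) * α₀') * (1 + kCol (d + 1) (ℓ + 1) * α₀' * (2 * ((d : ℝ) + 1)))) * (geo9K i).L *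
          Real.exp ((δ + ε) * ((ℓ : ℝ) + 4))) * (((geo9K i).len y)⁻¹ *
        (Real.sqrt (((((ℓ + 1 : ℕ) : ℝ) ^ (d + 1)) ^ lvl i.hN i.D i.hk y')⁻¹) * (geo9K i).len y') * Real.exp (-(δ * (geo9K i).dist y y'))) := by ring
    _ ≤ ((N : ℝ) ^ 4 * (1 + kCol (d + 1) (ℓ + 1) * α₀' * (2 * ((d : ℝ) + 1))) * (geo9K i).L * Real.exp ((δ + ε) * ((ℓ : ℝ) + 4))) * (((geo9K i).len y)⁻¹ *
        (Real.sqrt (((((ℓ + 1 : ℕ) : ℝ) ^ (d + 1)) ^ lvl i.hN i.D i.hk y')⁻¹) * (geo9K i).len y') * Real.exp (-(δ * (geo9K i).dist y y'))) :=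
        mul_le_mul_of_nonneg_right hc hrest
    _ = _ := by ring

/-- ★★ **THE BLOCK-L² LETTER OF THE KNIT `Q(U) = QknitY i U` BY ADJOINTNESS**: for a pair `(𝔮, 𝔮⋆)` with `𝔮(cfg U₁) = QknitY i (cfg U₁)` and `𝔮⋆(cfg U₁) = adjTrY (QknitY i (cfg U₁))`
(`adjTrY` IS the trace adjoint, def-Y `isAdjTr_adjTrY`; so the models are a transpose pair, `isTransposePair_QcoKHq_QscoKHq`), the `Q⋆` letter transposes
(`B9SectDL2Decay.blockBd_of_adjoint`) to `BlockBd (blkBK bI) blkHK (Q) ((N⁴(1 + 2(d+1)K_col α₀′)·L·e^{(δ+ε)(ℓ+4)})·(√(n_y⁻¹)Lʲη(y)·(L^{j′}η(y′))⁻¹)·e^{−δd})` under the same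
class and threshold. [cite: Balaban1985BackgroundPropagators, (3.13) p.393 («Q* the adjoint of Q»), (3.46) p.398 + remark after (3.47) p.398, Thm 3.13 p.426, (3.115) p.418, (3.35) p.396; Balaban1984PropagatorsII, Lemma 2.1 (2.60) p.234] -/
theorem blockBd_QcoKHq_QknitY_of_reg335P [Fintype (geo9K i).Site]
    (hβ1 : ∀ f : FBondY i, (geomT i.D).dist (β i.hN i.D i.hk (bI f)) (blkV1 i.hN i.D f) ≤ 1)
    {G : Subgroup (Matrix (Fin N) (Fin N) ℂ)ˣ} (hGU : G ≤ unitaryUnits (Matrix (Fin N) (Fin N) ℂ))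
    (B : B9.Backgrounds) (cfg : B.Cfg → CfgY (Matrix (Fin N) (Fin N) ℂ) i) (𝔮 : QLetterY (Matrix (Fin N) (Fin N) ℂ) i)
    (𝔮s : QsLetterY (Matrix (Fin N) (Fin N) ℂ) i) {U₁ : B.Cfg}
    (h𝔮 : 𝔮 (cfg U₁) = QknitY i (cfg U₁)) (h𝔮s : 𝔮s (cfg U₁) = adjTrY (QknitY i (cfg U₁))) {c₀ α₀ : ℝ} (hc : c₀ ≤ 10) (hMα : 0 ≤ (kGeo i).M * α₀)
    (hreg : (bg9KP (Matrix (Fin N) (Fin N) ℂ) G i).Reg335 c₀ α₀ (cfg U₁)) {α₀' : ℝ} (hα' : 0 < α₀') (hαQ : α₀' ≤ alphaQ (d + 1) (ℓ + 1))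
    (hK : Kpl i ((kGeo i).M * α₀) * (kGeo i).L ^ 4 < α₀') {δ ε : ℝ} (hδ : 0 ≤ δ) (hε : 0 < ε)
    (hM : Real.log (geo9K i).L ≤ ε * (2 * ((ℓ : ℝ) + 1) ^ 2 - 1) * (geo9K i).M) (R₀ : ℝ) (H₀ : Prop) :
    BlockBd (g := toB6 (geo9K i) R₀ H₀) (blkBK i bI) (blkHK i) (QcoKHq i (trBasis N) B cfg 𝔮 U₁)
      (fun y y' => ((N : ℝ) ^ 4 * (1 + kCol (d + 1) (ℓ + 1) * α₀' * (2 * ((d : ℝ) + 1))) * (geo9K i).L * Real.exp ((δ + ε) * ((ℓ : ℝ) + 4))) *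
        (Real.sqrt (((((ℓ + 1 : ℕ) : ℝ) ^ (d + 1)) ^ lvl i.hN i.D i.hk y)⁻¹) * (geo9K i).len y * ((geo9K i).len y')⁻¹) *
          Real.exp (-(δ * (geo9K i).dist y y'))) := by
  have hadjTr : B9Thm311ReadingCoords.IsAdjTr (fun _ => (1 : ℝ)) (fun _ => (1 : ℝ)) (𝔮 (cfg U₁)) (𝔮s (cfg U₁)) := by
    rw [h𝔮, h𝔮s]; exact isAdjTr_adjTrY _
  have hT : IsTransposePair (QcoKHq i (trBasis N) B cfg 𝔮 U₁) (QscoKHq i (trBasis N) B cfg 𝔮s U₁) :=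
    isTransposePair_QcoKHq_QscoKHq i B cfg U₁ 𝔮 𝔮s hadjTr
  have hdot : ∀ (u : XHK (TrIdx N) i → ℝ) (F : XBK (TrIdx N) i → ℝ),
      u ⬝ᵥ QcoKHq i (trBasis N) B cfg 𝔮 U₁ F = QscoKHq i (trBasis N) B cfg 𝔮s U₁ u ⬝ᵥ F := fun u F => by
    rw [dotProduct_comm u]
    show ∑ q, _ * u q = ∑ p, _ * F p
    rw [hT F u]
    exact Finset.sum_congr rfl fun p _ => mul_comm _ _
  have hK0 : 0 ≤ (N : ℝ) ^ 4 * (1 + kCol (d + 1) (ℓ + 1) * α₀' * (2 * ((d : ℝ) + 1))) * (geo9K i).L * Real.exp ((δ + ε) * ((ℓ : ℝ) + 4)) := by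
    have := kCol_nonneg (d + 1) (ℓ + 1); have := geo9K_one_le_L i; positivity
  have hadj := blockBd_of_adjoint (g := toB6 (geo9K i) R₀ H₀) (blk₁ := blkBK i bI) (blk₂ := blkHK i) hdot
    (blockBd_QscoKHq_adjTrY_QknitY_of_reg335P i hβ1 hGU B cfg 𝔮s h𝔮s hc hMα hreg hα' hαQ hK hδ hε hM R₀ H₀) (fun y y' =>
      mul_nonneg (mul_nonneg (mul_nonneg hK0 (inv_nonneg.mpr (geo9K_len_pos i _).le)) (mul_nonneg (Real.sqrt_nonneg _) (geo9K_len_pos i _).le))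
        (Real.exp_nonneg _))
  refine hadj.mono fun y y' => le_of_eq ?_
  change (geo9K i).Site at y y'
  rw [geo9K_dist_comm]
  ring

end Knit

end Summit.QuantumFields.YangMills.BalabanUVNodes.N06Thm312313ParLawsQL2

end
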